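/-
Copyright (c) 2026 the pub-hodgecm-mathlib formalisation cell (harness21).  Prover seat hodgecm-mathlib-K2E5-p16 (g4): Track B «K2-LIT»,
hLiu418 = stmt-HodgeConjecture-24832, ROAD Φ organ Φ6b-3 step (Y2) (dealer K2E5-plan (g5) GO 2026-09-04T06:21:58Z «ξ–η identity»): the
Hilbert-space model `WithLp 2 (ℝ × WithLp 2 (ℂ × ℝ))` of the chart `ℝ × ℂ × ℝ ≅ Herm₂(ℂ)` — transport, trace pairing, changes of variables; 2026-09-04.
-/
import Summits.HodgeConjecture.HodgeConjecture.Theorems.K2LiuHermTwoGammaDefs              -- ★ p857639: `hermTwo` + API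
import Mathlib.Analysis.InnerProductSpace.ProdL2
import Mathlib.MeasureTheory.Measure.Haar.InnerProductSpace
import Mathlib.MeasureTheory.Measure.Haar.NormedSpace
import Mathlib.MeasureTheory.Measure.Lebesgue.EqHaar
import Mathlib.Analysis.Normed.Lp.MeasurableSpace
import Mathlib.LinearAlgebra.Complex.FiniteDimensional
import HarnessLib

/-!
# Crux `HLiu418`, ROAD Φ, organ Φ6b-3 (Y2): the Hilbert-space model of `Herm₂(ℂ)` for Fourier analysis
# (`ℝ × ℂ × ℝ → WithLp 2 (ℝ × WithLp 2 (ℂ × ℝ))`, the trace pairing as an inner product, the two changes of variables)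

Cell `hodgecm-mathlib`, crux item hLiu418 = `stmt-HodgeConjecture-24832`, route of record `HCCMUnconditional`; squad K2, LEAD F0P6-plan (g12), co-dealer
K2E5-plan (g5), prover K2E5-p16 (g4).  THEOREMS ONLY (no `def`, no instance, no notation, no named-fact hypothesis, no `sorry`, default heartbeats);
lane `--supports stmt-HodgeConjecture-24832 --as helper`.

WHY.  Mathlib's Fourier inversion (`MeasureTheory.Integrable.fourierInv_fourier_eq`) lives on finite-dimensional real INNER-PRODUCT spaces with
their canonical `volume`; the chart `ℝ × ℂ × ℝ` (sup norm) is not one.  The map `ι c = toLp 2 (a, toLp 2 (z, b))` into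
`W = WithLp 2 (ℝ × WithLp 2 (ℂ × ℝ))` is MEASURE PRESERVING (★ `WithLp.volume_preserving_symm_measurableEquiv_toLp_prod`, twice) and carries the
trace pairing to the inner product up to doubling the off-diagonal coordinate: `tr(hermTwo v · hermTwo c) = ⟪ι v, ι (a_c, 2 z_c, b_c)⟫`.
WHAT IS PROVED (`ι` is written out as a lambda; no `def`).
* `measurePreserving_toLp2`, `integral_comp_toLp2` (`∫ F(ι c) dc = ∫ F`), `integrable_comp_toLp2_iff`;
* `inner_toLp2` (`⟪ι v, ι c⟫ = a_v a_c + re(z_c z̄_v) + b_v b_c`), `trace_hermTwo_eq_inner_dbl` (`tr(x_v x_c) = ⟪ι v, ι (dbl c)⟫`, `dbl c = (a, 2z, b)`),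
  `trace_hermTwo_eq_inner_dbl'` (the doubling on the other side);
* `map_dblZ_volume` (`volume ∘ dbl⁻¹ = ¼ · volume`), `integral_comp_dblZ` (`∫ F(dbl c) dc = ¼ ∫ F`), `integrable_comp_dblZ_iff`;
* `finrank_lp2 : finrank ℝ W = 4`, `integral_comp_smul_lp2` (`∫ F(R • y) dy = |R|⁻⁴ ∫ F`, ★ `Measure.integral_comp_smul`).
NEXT (Y3): `𝓕 (φ_s ∘ ι⁻¹)` in closed form from ★ `integral_gammaKernel_mul_cexp_trace`, inversion, Fubini ⇒ the ξ–η identity.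
HONEST LABEL.  Count-neutral helper of the K2_Liu road; it pays no socket by itself: `HC_CM` is proved only modulo the 7 printed citations
(2 remaining named inputs: hLiu418 = `stmt-HodgeConjecture-24832`, h413 = `stmt-HodgeConjecture-24833`) until rung 0 closes.
-/

set_option autoImplicit false
-- the mandated namespace repeats the single-problem summit's segment (`HodgeConjecture.HodgeConjecture`)
set_option linter.dupNamespace false

noncomputable section

open Complex MeasureTheory Set WithLp
open scoped ComplexOrder ComplexConjugate RealInnerProductSpace ENNReal

namespace Summit.HodgeConjecture.HodgeConjecture.Cruxes.HLiu418.K2LiuHermTwoChartLp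

open Summit.HodgeConjecture.HodgeConjecture.Cruxes.HLiu418.K2LiuHermTwoGammaDefs

/-! ## The transport `ι : ℝ × ℂ × ℝ → WithLp 2 (ℝ × WithLp 2 (ℂ × ℝ))` -/

/-- `ι` is measure preserving (product Lebesgue measure ↦ the Hilbert-space volume). -/
theorem measurePreserving_toLp2 :
    MeasurePreserving (fun c : ℝ × ℂ × ℝ => (toLp 2 (c.1, toLp 2 c.2) : WithLp 2 (ℝ × WithLp 2 (ℂ × ℝ)))) volume volume := by
  have h1 : MeasurePreserving (fun p : ℂ × ℝ => toLp 2 p) volume volume :=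
    (WithLp.volume_preserving_symm_measurableEquiv_toLp_prod ℂ ℝ).symm
  have h2 : MeasurePreserving (fun p : ℝ × WithLp 2 (ℂ × ℝ) => toLp 2 p) volume volume :=
    (WithLp.volume_preserving_symm_measurableEquiv_toLp_prod ℝ (WithLp 2 (ℂ × ℝ))).symm
  have h3 : MeasurePreserving (Prod.map (id : ℝ → ℝ) (fun p : ℂ × ℝ => toLp 2 p)) volume volume := by
    rw [Measure.volume_eq_prod, Measure.volume_eq_prod]
    exact (MeasurePreserving.id volume).prod h1
  exact h2.comp h3

/-- `ι` as a measurable equivalence (coercion lemma). -/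
theorem coe_toLp2Equiv :
    ⇑((MeasurableEquiv.prodCongr (MeasurableEquiv.refl ℝ) (MeasurableEquiv.toLp 2 (ℂ × ℝ))).trans
        (MeasurableEquiv.toLp 2 (ℝ × WithLp 2 (ℂ × ℝ)))) =
      fun c : ℝ × ℂ × ℝ => (toLp 2 (c.1, toLp 2 c.2) : WithLp 2 (ℝ × WithLp 2 (ℂ × ℝ))) := rfl

/-- `ι` is a measurable embedding. -/
theorem measurableEmbedding_toLp2 :
    MeasurableEmbedding (fun c : ℝ × ℂ × ℝ => (toLp 2 (c.1, toLp 2 c.2) : WithLp 2 (ℝ × WithLp 2 (ℂ × ℝ)))) := by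
  rw [← coe_toLp2Equiv]
  exact MeasurableEquiv.measurableEmbedding _

/-- Change of variables along `ι`: `∫ F(ι c) dc = ∫ F(y) dy`. -/
theorem integral_comp_toLp2 {E : Type*} [NormedAddCommGroup E] [NormedSpace ℝ E] (F : WithLp 2 (ℝ × WithLp 2 (ℂ × ℝ)) → E) :
    ∫ c : ℝ × ℂ × ℝ, F (toLp 2 (c.1, toLp 2 c.2)) = ∫ y : WithLp 2 (ℝ × WithLp 2 (ℂ × ℝ)), F y :=
  measurePreserving_toLp2.integral_comp measurableEmbedding_toLp2 F

/-- Integrability along `ι`. -/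
theorem integrable_comp_toLp2_iff {E : Type*} [NormedAddCommGroup E] (F : WithLp 2 (ℝ × WithLp 2 (ℂ × ℝ)) → E) :
    Integrable (fun c : ℝ × ℂ × ℝ => F (toLp 2 (c.1, toLp 2 c.2))) ↔ Integrable F :=
  measurePreserving_toLp2.integrable_comp_emb measurableEmbedding_toLp2

/-! ## The trace pairing as an inner product -/

/-- `⟪ι v, ι c⟫ = a_v a_c + re(z_c z̄_v) + b_v b_c`. -/
theorem inner_toLp2 (v c : ℝ × ℂ × ℝ) :
    ⟪(toLp 2 (v.1, toLp 2 v.2) : WithLp 2 (ℝ × WithLp 2 (ℂ × ℝ))), toLp 2 (c.1, toLp 2 c.2)⟫ =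
      v.1 * c.1 + ((c.2.1 * conj v.2.1).re + v.2.2 * c.2.2) := by
  rw [WithLp.prod_inner_apply]
  simp only [WithLp.prod_inner_apply, Real.inner_apply, Complex.inner]

/-- THE TRACE PAIRING IS THE INNER PRODUCT after doubling the off-diagonal coordinate of one argument:
`tr(hermTwo v · hermTwo c) = ⟪ι v, ι (dbl c)⟫`, `dbl c = (a_c, 2 z_c, b_c)` (as a real number cast to `ℂ`; `ι (dbl c)` is written as the
β-reduct of `(fun x => toLp 2 (x.1, toLp 2 x.2)) (dbl c)`, the form in which it arises). -/
theorem trace_hermTwo_eq_inner_dbl (v c : ℝ × ℂ × ℝ) :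
    (hermTwo v * hermTwo c).trace =
      ((⟪(toLp 2 (v.1, toLp 2 v.2) : WithLp 2 (ℝ × WithLp 2 (ℂ × ℝ))),
          toLp 2 ((c.1, (2 : ℝ) • c.2.1, c.2.2).1, toLp 2 (c.1, (2 : ℝ) • c.2.1, c.2.2).2)⟫ : ℝ) : ℂ) := by
  rw [trace_hermTwo_mul_hermTwo, inner_toLp2]
  congr 1
  simp only [Complex.real_smul]
  have h1 : (c.2.1 * conj v.2.1).re = (v.2.1 * conj c.2.1).re := by
    rw [← Complex.conj_re (v.2.1 * conj c.2.1), map_mul, Complex.conj_conj, mul_comm]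
  have h2 : ((((2 : ℝ) : ℂ)) * c.2.1 * conj v.2.1).re = 2 * (c.2.1 * conj v.2.1).re := by
    rw [mul_assoc, Complex.re_ofReal_mul]
  rw [h2, h1]
  ring

/-- The same pairing with the doubling on the FIRST argument. -/
theorem trace_hermTwo_eq_inner_dbl' (v c : ℝ × ℂ × ℝ) :
    (hermTwo v * hermTwo c).trace =
      ((⟪(toLp 2 ((v.1, (2 : ℝ) • v.2.1, v.2.2).1, toLp 2 (v.1, (2 : ℝ) • v.2.1, v.2.2).2) : WithLp 2 (ℝ × WithLp 2 (ℂ × ℝ))),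
          toLp 2 (c.1, toLp 2 c.2)⟫ : ℝ) : ℂ) := by
  rw [← Matrix.trace_mul_comm, trace_hermTwo_eq_inner_dbl, real_inner_comm]

/-! ## The doubling change of variables `dbl c = (a, 2z, b)` on `ℝ × ℂ × ℝ` -/

/-- Right scalar multiples pass through `Measure.prod` (the form Mathlib lacks; via `prod_swap` + `prod_smul_left`). -/
theorem volume_prod_smul (c : ℝ≥0∞) :
    (volume : Measure ℝ).prod (c • (volume : Measure (ℂ × ℝ))) = c • ((volume : Measure ℝ).prod (volume : Measure (ℂ × ℝ))) := by
  calc (volume : Measure ℝ).prod (c • (volume : Measure (ℂ × ℝ)))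
      = Measure.map Prod.swap ((c • (volume : Measure (ℂ × ℝ))).prod (volume : Measure ℝ)) := (Measure.prod_swap).symm
    _ = Measure.map Prod.swap (c • ((volume : Measure (ℂ × ℝ)).prod (volume : Measure ℝ))) := by rw [Measure.prod_smul_left]
    _ = c • Measure.map Prod.swap ((volume : Measure (ℂ × ℝ)).prod (volume : Measure ℝ)) := Measure.map_smul _ _ _
    _ = c • ((volume : Measure ℝ).prod (volume : Measure (ℂ × ℝ))) := by rw [Measure.prod_swap]

/-- `volume` pushed forward along `dbl` is `|(2²)⁻¹| · volume = ¼ · volume`. -/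
theorem map_dblZ_volume :
    Measure.map (fun c : ℝ × ℂ × ℝ => (c.1, (2 : ℝ) • c.2.1, c.2.2)) volume =
      ENNReal.ofReal |((2 : ℝ) ^ 2)⁻¹| • (volume : Measure (ℝ × ℂ × ℝ)) := by
  have hfun : (fun c : ℝ × ℂ × ℝ => (c.1, (2 : ℝ) • c.2.1, c.2.2)) = Prod.map id (Prod.map (fun z : ℂ => (2 : ℝ) • z) id) := by
    funext c
    rfl
  have hC : Measure.map (fun z : ℂ => (2 : ℝ) • z) volume = ENNReal.ofReal |((2 : ℝ) ^ 2)⁻¹| • (volume : Measure ℂ) := by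
    rw [Measure.map_addHaar_smul volume (two_ne_zero), Complex.finrank_real_complex]
  rw [hfun, Measure.volume_eq_prod, Measure.volume_eq_prod,
    ← Measure.map_prod_map _ _ measurable_id ((measurable_const_smul (2 : ℝ)).prodMap measurable_id), Measure.map_id,
    ← Measure.map_prod_map _ _ (measurable_const_smul (2 : ℝ)) measurable_id, Measure.map_id, hC, Measure.prod_smul_left]
  exact volume_prod_smul _

/-- `dbl` is measurable. -/
theorem measurable_dblZ : Measurable (fun c : ℝ × ℂ × ℝ => (c.1, (2 : ℝ) • c.2.1, c.2.2)) := by fun_prop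

/-- CHANGE OF VARIABLES along `dbl`: `∫ F(a, 2z, b) = ¼ ∫ F`. -/
theorem integral_comp_dblZ {E : Type*} [NormedAddCommGroup E] [NormedSpace ℝ E] [CompleteSpace E] (F : ℝ × ℂ × ℝ → E)
    (hF : AEStronglyMeasurable F volume) :
    ∫ c : ℝ × ℂ × ℝ, F (c.1, (2 : ℝ) • c.2.1, c.2.2) = (4⁻¹ : ℝ) • ∫ c : ℝ × ℂ × ℝ, F c := by
  have hF' : AEStronglyMeasurable F (Measure.map (fun c : ℝ × ℂ × ℝ => (c.1, (2 : ℝ) • c.2.1, c.2.2)) volume) := by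
    rw [map_dblZ_volume]
    exact hF.smul_measure _
  rw [← integral_map measurable_dblZ.aemeasurable hF', map_dblZ_volume, integral_smul_measure,
    ENNReal.toReal_ofReal (abs_nonneg _)]
  norm_num

/-- Integrability along `dbl`. -/
theorem integrable_comp_dblZ_iff {E : Type*} [NormedAddCommGroup E] (F : ℝ × ℂ × ℝ → E) (hF : AEStronglyMeasurable F volume) :
    Integrable (fun c : ℝ × ℂ × ℝ => F (c.1, (2 : ℝ) • c.2.1, c.2.2)) ↔ Integrable F := by
  have hF' : AEStronglyMeasurable F (Measure.map (fun c : ℝ × ℂ × ℝ => (c.1, (2 : ℝ) • c.2.1, c.2.2)) volume) := by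
    rw [map_dblZ_volume]
    exact hF.smul_measure _
  have h := integrable_map_measure hF' measurable_dblZ.aemeasurable
  rw [Function.comp_def] at h
  rw [← h, map_dblZ_volume]
  exact integrable_smul_measure (by norm_num [ENNReal.ofReal_eq_zero]) ENNReal.ofReal_ne_top

/-! ## Uniform scaling on the Hilbert-space model -/

/-- `finrank ℝ (WithLp 2 (ℝ × WithLp 2 (ℂ × ℝ))) = 4`. -/
theorem finrank_lp2 : Module.finrank ℝ (WithLp 2 (ℝ × WithLp 2 (ℂ × ℝ))) = 4 := by
  rw [(WithLp.linearEquiv 2 ℝ (ℝ × WithLp 2 (ℂ × ℝ))).finrank_eq, Module.finrank_prod,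
    (WithLp.linearEquiv 2 ℝ (ℂ × ℝ)).finrank_eq, Module.finrank_prod, Complex.finrank_real_complex, Module.finrank_self]

/-- Uniform scaling: `∫ F(R • y) dy = |R⁴|⁻¹ ∫ F` on the model space. -/
theorem integral_comp_smul_lp2 {E : Type*} [NormedAddCommGroup E] [NormedSpace ℝ E] (F : WithLp 2 (ℝ × WithLp 2 (ℂ × ℝ)) → E) (R : ℝ) :
    ∫ y : WithLp 2 (ℝ × WithLp 2 (ℂ × ℝ)), F (R • y) = |(R ^ 4)⁻¹| • ∫ y : WithLp 2 (ℝ × WithLp 2 (ℂ × ℝ)), F y := by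
  rw [Measure.integral_comp_smul volume F R, finrank_lp2]

end Summit.HodgeConjecture.HodgeConjecture.Cruxes.HLiu418.K2LiuHermTwoChartLp

end
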